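import Literature.NumberTheory.GaloisRepresentations.LubinTateColemanRelativeLogDerivDenseTwo
import Literature.NumberTheory.GaloisRepresentations.LubinTateColemanRelativeNormClosedTwo
import HarnessLib

/-!
# `q = 2`, relative situation: Coleman's `δ_E` maps the twisted-`𝒩_E`-invariant units ONTO the twisted `𝒮_E`-eigenseries
# (de Shalit I §3.12 Corollary over an unramified base `k' = E`)

De Shalit, *Iwasawa theory of elliptic curves with complex multiplication* (1987), Ch. I §3.12 Corollary: over the unramified base
`k'` with Frobenius `φ`, "`δ` maps `{g : 𝒩g = g^φ}` ONTO `{h : 𝒮h = h^φ}`".  The tree's `LubinTateColemanLogDerivLimit` /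
`LubinTateColemanLogDerivSurjTwo` do the absolute case; THIS FILE assembles the relative, twisted statement at `q = 2`
(`f = πX + X²`, `π = 2u` with `u ∈ 𝒪_F^×` and `π ≡ m₁ (mod π²)` for some `m₁ ∈ ℕ` — both automatic for `F = ℚ₂`; `E ⊇ F` finite;
`ψ` a ring automorphism of `𝒪_E` over `𝒪_F` with `ψ(c) ≡ c² (mod π)`) from

* the residual step `h ≡ δ_E g (mod π)` (`LubinTateColemanRelativeLogDerivSurjModTwo`),
* the coherent successive approximation `G_0, G_1 = G_0 g_0^{m₁}, …` (`RelApproxData`, `relApproxSeq`, `(π, X)`-adically Cauchy: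
  `relApproxSeq_succ_sub_mem`), its `(π, X)`-adic limit (`exists_forall_sub_mem_adicFiltGen`), and
* the algebraic closedness of twisted-`𝒩_E`-invariance under such limits (`LubinTateColemanRelativeNormClosedTwo`):

★★★ `exists_relNormTwo_eq_map_relLogDeriv_eq` — **every `h ∈ 𝒪_E⟦X⟧` with `𝒮_E h = π·h^ψ` is `δ_E G` for a PRINCIPAL unit `G` with
`𝒩_E G = G^ψ`**; `exists_relNormTwo_eq_map_relLogDeriv_eq_iff` (`δ_E {G : 𝒩_E G = G^ψ} = {h : 𝒮_E h = π h^ψ}`).  With the Frobenius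
`φ` of an unramified `E` this is the surjectivity half of de Shalit's Theorem I.3.7 over `k'` (the relative Coleman series
`g_β`, `LubinTateColemanRelativeSeriesTwo`, are exactly the units with `𝒩_E g = g^φ`).  Everything PROVED (0 sorry).

## References

* E. de Shalit, *Iwasawa theory of elliptic curves with complex multiplication* (1987), Ch. I §3.12 Corollary. [deShalit1987]
* R. Coleman, *Division values in local fields*, Invent. Math. 53 (1979), Thm. A, §IV. [Coleman1979]
-/

noncomputable section

open scoped PowerSeries.WithPiTopology

namespace Literature.NumberTheory.GaloisRepresentations

/-- `a ∈ (s)`, `G ∈ coeffIdeal (t)` ⟹ `C a · G ∈ coeffIdeal (s t)`. [folklore] -/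
private theorem C_mul_mem_coeffIdeal_span_mul₃ {S : Type*} [CommRing S] {a s t : S} (ha : a ∈ Ideal.span {s})
    {G : PowerSeries S} (hG : G ∈ LubinTate.coeffIdeal (Ideal.span {t})) :
    PowerSeries.C a * G ∈ LubinTate.coeffIdeal (Ideal.span {s * t}) := by
  intro k
  rw [PowerSeries.coeff_C_mul, ← Ideal.span_singleton_mul_span_singleton]
  exact Ideal.mul_mem_mul ha (hG k)

/-- `ϖ² ∣ ϖ − m ⟹ ϖ^{N+1} ∣ ϖ^N − m^N` (`N ≥ 1`). [folklore] -/
private theorem pow_succ_dvd_pow_sub_pow₃ {R : Type*} [CommRing R] {ϖ m : R} (h : ϖ ^ 2 ∣ ϖ - m) (N : ℕ) (hN : 1 ≤ N) :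
    ϖ ^ (N + 1) ∣ ϖ ^ N - m ^ N := by
  have hm : ϖ ∣ m := by
    obtain ⟨c, hc⟩ := h
    exact ⟨1 - ϖ * c, by linear_combination -hc⟩
  induction N, hN using Nat.le_induction with
  | base => simpa using h
  | succ N hN ih =>
    have e : ϖ ^ (N + 1) - m ^ (N + 1) = ϖ * (ϖ ^ N - m ^ N) + (ϖ - m) * m ^ N := by ring
    rw [e, pow_succ']
    refine dvd_add (mul_dvd_mul (dvd_refl ϖ) ih) ?_
    have h2 : ϖ ^ 2 * ϖ ^ N ∣ (ϖ - m) * m ^ N := mul_dvd_mul h (pow_dvd_pow_of_dvd hm N)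
    have e2 : ϖ * ϖ ^ (N + 1) = ϖ ^ 2 * ϖ ^ N := by ring
    rw [e2]
    exact h2

section RelativeLimit

open GaloisRepresentations.IsNonarchimedeanLocalField LubinTate ValuativeRel

variable (F : Type*) [Field F] [ValuativeRel F] [TopologicalSpace F] [IsNonarchimedeanLocalField F]

attribute [local instance] ltNormUniformSpace ltNormIsUniformAddGroup rk1 nF nE fintypeResidueField

variable {F}
variable {π : 𝒪[F]} (hπ : (valuation F).IsUniformizer (π : F))
variable (E : IntermediateField F (AlgebraicClosure F)) [FiniteDimensional F E]

include hπ in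
/-- `m₁` is even when `π ∣ m₁` and `|𝓀_F| = 2`. [cite: deShalit1987, Ch. I §3.12 Corollary (proof)] -/
private theorem two_dvd_of_sq_dvd' (hq : residueFieldCard F = 2) {m₁ : ℕ} (hm₁ : LTCoeff.of F π ^ 2 ∣ LTCoeff.of F π - m₁) :
    2 ∣ m₁ := by
  haveI := charP_two_of_residueFieldCard (F := F) hq
  have hdvd : LTCoeff.of F π ∣ (m₁ : LTCoeff F) := by
    obtain ⟨c, hc⟩ := hm₁
    exact ⟨1 - LTCoeff.of F π * c, by linear_combination -hc⟩
  have h0 : IsLocalRing.residue 𝒪[F] ((LTCoeff.of F).symm (m₁ : LTCoeff F)) = 0 :=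
    (residue_eq_zero_iff_mem hπ _).mpr (Ideal.mem_span_singleton.mpr hdvd)
  rw [map_natCast, map_natCast] at h0
  exact (CharP.cast_eq_zero_iff 𝓀[F] 2 m₁).mp h0

variable (hq : residueFieldCard F = 2)

/-! ### The coherent successive approximation -/

/-- Data of the `N`-th approximation: a principal unit `G` with `𝒩_E G = G^ψ` and `h ≡ δ_E G (mod π^{N+1})`.
[cite: deShalit1987, Ch. I §3.12 Corollary (proof)] -/
structure RelApproxData (ψ : unitBall E →+* unitBall E) (h : PowerSeries (unitBall E)) (N : ℕ) where
  /-- the approximating unit -/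
  G : (PowerSeries (unitBall E))ˣ
  /-- `𝒩_E G = G^ψ` -/
  norm_eq : relNormTwo hπ E hq (G : PowerSeries (unitBall E)) = PowerSeries.map ψ (G : PowerSeries (unitBall E))
  /-- `G(0) ≡ 1 (mod π)` -/
  principal : PowerSeries.constantCoeff (G : PowerSeries (unitBall E)) - 1 ∈ Ideal.span {algebraMap 𝒪[F] (unitBall E) π}
  /-- `h ≡ δ_E G (mod π^{N+1})` -/
  approx : h - relLogDeriv hπ E G ∈ coeffIdeal (Ideal.span {algebraMap 𝒪[F] (unitBall E) π ^ (N + 1)})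

variable (u : (LTCoeff F)ˣ) (hu : LTCoeff.of F π = residueFieldCard F * u) {m₁ : ℕ}
  (hm₁ : LTCoeff.of F π ^ 2 ∣ LTCoeff.of F π - m₁) (ψ : unitBall E ≃+* unitBall E)
  (hψF : ∀ a : LTCoeff F, ψ (algebraMap (LTCoeff F) (unitBall E) a) = algebraMap (LTCoeff F) (unitBall E) a)
  (hψ2 : ∀ c : unitBall E, ψ c - c ^ 2 ∈ Ideal.span {algebraMap 𝒪[F] (unitBall E) π})
  {h : PowerSeries (unitBall E)}
  (hh : relTraceTwo hπ E hq h = PowerSeries.C (algebraMap 𝒪[F] (unitBall E) π) * PowerSeries.map (ψ : unitBall E →+* unitBall E) h)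

include hu hm₁ hψF hψ2 hh in
set_option maxHeartbeats 800000 in
/-- **The step**: from an `N`-th approximation `G`, a principal `g` with `𝒩_E g = g^ψ` such that `G · g^{m₁^{N+1}}` is an
`(N+1)`-th approximation (`h − δ_E G = π^{N+1} h'`, `h' ≡ δ_E g (mod π)`, `π^{N+1} ≡ m₁^{N+1} (mod π^{N+2})`).
[cite: deShalit1987, Ch. I §3.12 Corollary (proof)] -/
theorem exists_relApprox_step {N : ℕ} (d : RelApproxData hπ E hq (ψ : unitBall E →+* unitBall E) h N) :
    ∃ g : (PowerSeries (unitBall E))ˣ,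
      relNormTwo hπ E hq (g : PowerSeries (unitBall E)) = PowerSeries.map (ψ : unitBall E →+* unitBall E) g ∧
      PowerSeries.constantCoeff (g : PowerSeries (unitBall E)) - 1 ∈ Ideal.span {algebraMap 𝒪[F] (unitBall E) π} ∧
      relNormTwo hπ E hq ((d.G * g ^ (m₁ ^ (N + 1)) : (PowerSeries (unitBall E))ˣ) : PowerSeries (unitBall E)) =
        PowerSeries.map (ψ : unitBall E →+* unitBall E) ((d.G * g ^ (m₁ ^ (N + 1)) : (PowerSeries (unitBall E))ˣ) : PowerSeries (unitBall E)) ∧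
      PowerSeries.constantCoeff ((d.G * g ^ (m₁ ^ (N + 1)) : (PowerSeries (unitBall E))ˣ) : PowerSeries (unitBall E)) - 1 ∈
        Ideal.span {algebraMap 𝒪[F] (unitBall E) π} ∧
      h - relLogDeriv hπ E (d.G * g ^ (m₁ ^ (N + 1))) ∈ coeffIdeal (Ideal.span {algebraMap 𝒪[F] (unitBall E) π ^ (N + 2)}) := by
  have hψa : ∀ a : LTCoeff F, (ψ : unitBall E →+* unitBall E) (algebraMap (LTCoeff F) (unitBall E) a) =
      algebraMap (LTCoeff F) (unitBall E) a := hψF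
  have hψ : (ψ : unitBall E →+* unitBall E) (algebraMap 𝒪[F] (unitBall E) π) = algebraMap 𝒪[F] (unitBall E) π :=
    hψF (LTCoeff.of F π)
  have hm₁E : algebraMap 𝒪[F] (unitBall E) π ^ 2 ∣ algebraMap 𝒪[F] (unitBall E) π - (m₁ : unitBall E) := by
    have h1 := map_dvd (algebraMap (LTCoeff F) (unitBall E)) hm₁
    rwa [map_pow, map_sub, map_natCast] at h1
  have key : ∀ x : unitBall E, x - 1 ∈ Ideal.span {algebraMap 𝒪[F] (unitBall E) π} ↔
      Ideal.Quotient.mk (Ideal.span {algebraMap 𝒪[F] (unitBall E) π}) x = 1 := fun x => by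
    rw [← map_one (Ideal.Quotient.mk (Ideal.span {algebraMap 𝒪[F] (unitBall E) π})), Ideal.Quotient.eq]
  have hE' : relTraceTwo hπ E hq (h - relLogDeriv hπ E d.G) =
      PowerSeries.C (algebraMap 𝒪[F] (unitBall E) π) * PowerSeries.map (ψ : unitBall E →+* unitBall E) (h - relLogDeriv hπ E d.G) := by
    rw [relTraceTwo_sub hπ E hq, hh, relTraceTwo_relLogDeriv_of_relNormTwo_eq_map hπ E hq hψa d.G d.norm_eq,
      map_sub (PowerSeries.map (ψ : unitBall E →+* unitBall E)), mul_sub]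
  obtain ⟨hN', hhN', hEN⟩ := exists_eq_C_pow_mul_of_relTraceTwo_eq hπ E hq hψ (N + 1) _ hE' d.approx
  obtain ⟨gN, hNgN, hgN0, hgN⟩ := exists_relNormTwo_eq_map_sub_relLogDeriv_mem hπ E hq u hu ψ hψF hψ2 hN' hEN
  have hmN := pow_succ_dvd_pow_sub_pow₃ hm₁E (N + 1) (by omega)
  refine ⟨gN, hNgN, hgN0, ?_, ?_, ?_⟩
  · rw [Units.val_mul, Units.val_pow_eq_pow_val, ← relNormTwoHom_apply, map_mul (relNormTwoHom hπ E hq),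
      map_pow (relNormTwoHom hπ E hq), relNormTwoHom_apply, relNormTwoHom_apply, d.norm_eq, hNgN,
      map_mul (PowerSeries.map (ψ : unitBall E →+* unitBall E)), map_pow (PowerSeries.map (ψ : unitBall E →+* unitBall E))]
  · have hG0 := d.principal
    rw [key] at hG0 hgN0 ⊢
    rw [Units.val_mul, Units.val_pow_eq_pow_val, map_mul (PowerSeries.constantCoeff (R := unitBall E)),
      map_pow (PowerSeries.constantCoeff (R := unitBall E)),
      map_mul (Ideal.Quotient.mk (Ideal.span {algebraMap 𝒪[F] (unitBall E) π})),
      map_pow (Ideal.Quotient.mk (Ideal.span {algebraMap 𝒪[F] (unitBall E) π})), hG0, hgN0, one_pow, mul_one]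
  · have e : h - relLogDeriv hπ E (d.G * gN ^ (m₁ ^ (N + 1))) =
        PowerSeries.C (algebraMap 𝒪[F] (unitBall E) π ^ (N + 1)) * (hN' - relLogDeriv hπ E gN) +
          PowerSeries.C (algebraMap 𝒪[F] (unitBall E) π ^ (N + 1) - (m₁ : unitBall E) ^ (N + 1)) * relLogDeriv hπ E gN := by
      have e1 : PowerSeries.C (algebraMap 𝒪[F] (unitBall E) π ^ (N + 1) - (m₁ : unitBall E) ^ (N + 1)) =
          PowerSeries.C (algebraMap 𝒪[F] (unitBall E) π ^ (N + 1)) - ((m₁ : PowerSeries (unitBall E))) ^ (N + 1) := by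
        rw [map_sub (PowerSeries.C (R := unitBall E)), map_pow (PowerSeries.C (R := unitBall E)) (m₁ : unitBall E) (N + 1), map_natCast]
      rw [relLogDeriv_mul, relLogDeriv_pow, Nat.cast_pow, e1]
      linear_combination hhN'
    rw [e]
    refine add_mem ?_ ?_
    · have := C_mul_mem_coeffIdeal_span_mul₃ (Ideal.mem_span_singleton_self (algebraMap 𝒪[F] (unitBall E) π ^ (N + 1))) hgN
      rwa [← pow_succ] at this
    · exact C_mul_mem_coeffIdeal (Ideal.mem_span_singleton.mpr hmN) _

/-- **The coherent sequence of approximations** `G_0, G_1 = G_0 g_0^{m₁}, G_2 = G_1 g_1^{m₁²}, …`.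
[cite: deShalit1987, Ch. I §3.12 Corollary (proof)] -/
noncomputable def relApproxSeq : (N : ℕ) → RelApproxData hπ E hq (ψ : unitBall E →+* unitBall E) h N
  | 0 =>
    let e := exists_relNormTwo_eq_map_sub_relLogDeriv_mem hπ E hq u hu ψ hψF hψ2 h hh
    ⟨e.choose, e.choose_spec.1, e.choose_spec.2.1, by rw [zero_add, pow_one]; exact e.choose_spec.2.2⟩
  | N + 1 =>
    let d := relApproxSeq N
    let e := exists_relApprox_step hπ E hq u hu hm₁ ψ hψF hψ2 hh d
    ⟨d.G * e.choose ^ (m₁ ^ (N + 1)), e.choose_spec.2.2.1, e.choose_spec.2.2.2.1, e.choose_spec.2.2.2.2⟩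

/-- `G_{N+1} = G_N · g_N^{m₁^{N+1}}` with `g_N` principal. [cite: deShalit1987, Ch. I §3.12 Corollary (proof)] -/
theorem relApproxSeq_succ (N : ℕ) :
    ∃ g : (PowerSeries (unitBall E))ˣ,
      PowerSeries.constantCoeff (g : PowerSeries (unitBall E)) - 1 ∈ Ideal.span {algebraMap 𝒪[F] (unitBall E) π} ∧
      (relApproxSeq hπ E hq u hu hm₁ ψ hψF hψ2 hh (N + 1)).G = (relApproxSeq hπ E hq u hu hm₁ ψ hψF hψ2 hh N).G * g ^ (m₁ ^ (N + 1)) :=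
  ⟨(exists_relApprox_step hπ E hq u hu hm₁ ψ hψF hψ2 hh (relApproxSeq hπ E hq u hu hm₁ ψ hψF hψ2 hh N)).choose,
    (exists_relApprox_step hπ E hq u hu hm₁ ψ hψF hψ2 hh (relApproxSeq hπ E hq u hu hm₁ ψ hψF hψ2 hh N)).choose_spec.2.1, rfl⟩

include hπ in
/-- ★ **`G_{N+1} − G_N ∈ I_{N+2}`**: the sequence is `(π, X)`-adically Cauchy (`g` principal ⟹ `g^{2^{N+1}} − 1 ∈ I_{N+2}`, and
`m₁` is even). [cite: deShalit1987, Ch. I §3.12 Corollary (proof)] -/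
theorem relApproxSeq_succ_sub_mem (N : ℕ) :
    ((relApproxSeq hπ E hq u hu hm₁ ψ hψF hψ2 hh (N + 1)).G : PowerSeries (unitBall E)) -
        (relApproxSeq hπ E hq u hu hm₁ ψ hψF hψ2 hh N).G ∈
      adicFiltGen (algebraMap 𝒪[F] (unitBall E) π) (N + 2) := by
  obtain ⟨g, hg0, hG⟩ := relApproxSeq_succ hπ E hq u hu hm₁ ψ hψF hψ2 hh N
  obtain ⟨r, hr⟩ := two_dvd_of_sq_dvd' hπ hq hm₁
  have key : (g : PowerSeries (unitBall E)) ^ (m₁ ^ (N + 1)) - 1 ∈ adicFiltGen (algebraMap 𝒪[F] (unitBall E) π) (N + 2) := by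
    rw [hr, mul_pow, pow_mul]
    exact pow_sub_one_mem_adicFiltGen
      (pow_two_pow_sub_one_mem_adicFiltGen (two_mem_span_algebraMap_pi hπ E hq) (sub_one_mem_adicFiltGen_one hg0) (N + 1)) _
  rw [hG, Units.val_mul, Units.val_pow_eq_pow_val, ← mul_sub_one]
  exact Ideal.mul_mem_left _ _ key

/-! ### The limit -/

include hu hm₁ hψF hψ2 hh in
set_option maxHeartbeats 800000 in
/-- ★★★ **Coleman's `δ_E` attains every twisted `𝒮_E`-eigenseries** (de Shalit I §3.12 Corollary, relative situation, `q = 2`;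
`π = 2u`, `u ∈ 𝒪_F^×`, `π ≡ m₁ (mod π²)` with `m₁ ∈ ℕ` — e.g. `F = ℚ₂`; `ψ` a ring automorphism of `𝒪_E` over `𝒪_F` with
`ψ(c) ≡ c² (mod π)`): for every `h ∈ 𝒪_E⟦X⟧` with `𝒮_E h = π·h^ψ` there is a PRINCIPAL unit `G ∈ 𝒪_E⟦X⟧ˣ` with **`𝒩_E G = G^ψ` and
`δ_E G = h`** — the `(π, X)`-adic limit of the approximations `G_N` (twisted invariance passes to the limit by
`relNormTwo_eq_map_of_forall_sub_mem`). [cite: deShalit1987, Ch. I §3.12 Corollary] -/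
theorem exists_relNormTwo_eq_map_relLogDeriv_eq :
    ∃ G : (PowerSeries (unitBall E))ˣ,
      relNormTwo hπ E hq (G : PowerSeries (unitBall E)) = PowerSeries.map (ψ : unitBall E →+* unitBall E) G ∧
      PowerSeries.constantCoeff (G : PowerSeries (unitBall E)) - 1 ∈ Ideal.span {algebraMap 𝒪[F] (unitBall E) π} ∧
      relLogDeriv hπ E G = h := by
  haveI := isAdicComplete_span_algebraMap_pi hπ E
  have hψ : (ψ : unitBall E →+* unitBall E) (algebraMap 𝒪[F] (unitBall E) π) = algebraMap 𝒪[F] (unitBall E) π :=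
    hψF (LTCoeff.of F π)
  -- the `(π, X)`-adic limit of the Cauchy sequence `G_N`
  obtain ⟨G, hGN⟩ := exists_forall_sub_mem_adicFiltGen (p := algebraMap 𝒪[F] (unitBall E) π)
    (fun N => ((relApproxSeq hπ E hq u hu hm₁ ψ hψF hψ2 hh N).G : PowerSeries (unitBall E)))
    (fun N => adicFiltGen_mono (by omega) (relApproxSeq_succ_sub_mem hπ E hq u hu hm₁ ψ hψF hψ2 hh N))
  -- `G` is a principal unit
  have hG0 : PowerSeries.constantCoeff G - 1 ∈ Ideal.span {algebraMap 𝒪[F] (unitBall E) π} := by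
    have h1 := hGN 0 0
    rw [Nat.sub_zero, zero_add, pow_one, map_sub, PowerSeries.coeff_zero_eq_constantCoeff_apply,
      PowerSeries.coeff_zero_eq_constantCoeff_apply] at h1
    have h2 := (relApproxSeq hπ E hq u hu hm₁ ψ hψF hψ2 hh 0).principal
    have e : PowerSeries.constantCoeff G - 1 =
        (PowerSeries.constantCoeff G - PowerSeries.constantCoeff ((relApproxSeq hπ E hq u hu hm₁ ψ hψF hψ2 hh 0).G : PowerSeries (unitBall E))) +
          (PowerSeries.constantCoeff ((relApproxSeq hπ E hq u hu hm₁ ψ hψF hψ2 hh 0).G : PowerSeries (unitBall E)) - 1) := by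
      ring
    rw [e]
    exact add_mem h1 h2
  have hGu : IsUnit G := by
    rw [PowerSeries.isUnit_iff_constantCoeff]
    have hCu : IsUnit (PowerSeries.C (PowerSeries.constantCoeff G)) := by
      refine isUnit_of_sub_mem_coeffIdeal_span (p := algebraMap 𝒪[F] (unitBall E) π) isUnit_one ?_
      intro k
      rw [map_sub (PowerSeries.coeff k), PowerSeries.coeff_C, PowerSeries.coeff_one]
      split_ifs with hk
      · exact hG0
      · rw [sub_zero]; exact zero_mem _
    rwa [PowerSeries.isUnit_iff_constantCoeff, PowerSeries.constantCoeff_C] at hCu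
  refine ⟨hGu.unit, ?_, by rw [IsUnit.unit_spec]; exact hG0, ?_⟩
  · -- twisted `𝒩_E`-invariance passes to the limit
    rw [IsUnit.unit_spec]
    exact relNormTwo_eq_map_of_forall_sub_mem hπ E hq hψ G fun N =>
      ⟨(relApproxSeq hπ E hq u hu hm₁ ψ hψF hψ2 hh N).G, (relApproxSeq hπ E hq u hu hm₁ ψ hψF hψ2 hh N).norm_eq, hGN N⟩
  · -- `δ_E G = h`: for every `N`, `h − δ_E G = (h − δ_E G_N) − δ_E W_N` with `W_N − 1 ∈ I_{N+1}`, `δ_E W_N ∈ I_N`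
    haveI := (isAdicComplete_span_algebraMap_pi hπ E).toIsHausdorff
    rw [eq_comm, ← sub_eq_zero]
    refine eq_zero_of_forall_mem_adicFiltGen (p := algebraMap 𝒪[F] (unitBall E) π) fun N => ?_
    obtain ⟨W, hW⟩ : ∃ W : (PowerSeries (unitBall E))ˣ, W = hGu.unit * ((relApproxSeq hπ E hq u hu hm₁ ψ hψF hψ2 hh N).G)⁻¹ :=
      ⟨_, rfl⟩
    have hGW : hGu.unit = (relApproxSeq hπ E hq u hu hm₁ ψ hψF hψ2 hh N).G * W := by
      rw [hW, mul_left_comm, mul_inv_cancel, mul_one]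
    have hW1 : (W : PowerSeries (unitBall E)) - 1 ∈ adicFiltGen (algebraMap 𝒪[F] (unitBall E) π) (N + 1) := by
      have e : (W : PowerSeries (unitBall E)) - 1 =
          (G - ((relApproxSeq hπ E hq u hu hm₁ ψ hψF hψ2 hh N).G : PowerSeries (unitBall E))) *
            ↑((relApproxSeq hπ E hq u hu hm₁ ψ hψF hψ2 hh N).G⁻¹) := by
        rw [hW, Units.val_mul, IsUnit.unit_spec, sub_mul, Units.mul_inv]
      rw [e]
      exact Ideal.mul_mem_right _ _ (hGN N)
    have hδW : relLogDeriv hπ E W ∈ adicFiltGen (algebraMap 𝒪[F] (unitBall E) π) N := by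
      rw [relLogDeriv_def, PowerSeries.dlog_def]
      have hd' : PowerSeries.derivative (unitBall E) (W : PowerSeries (unitBall E)) ∈ adicFiltGen (algebraMap 𝒪[F] (unitBall E) π) N := by
        have := derivative_mem_adicFiltGen (p := algebraMap 𝒪[F] (unitBall E) π) hW1
        rwa [map_sub (PowerSeries.derivative (unitBall E)), (PowerSeries.derivative (unitBall E)).map_one_eq_zero, sub_zero,
          Nat.add_sub_cancel] at this
      exact Ideal.mul_mem_left _ _ (Ideal.mul_mem_right _ _ hd')
    have e : h - relLogDeriv hπ E hGu.unit = (h - relLogDeriv hπ E (relApproxSeq hπ E hq u hu hm₁ ψ hψF hψ2 hh N).G) -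
        relLogDeriv hπ E W := by
      rw [hGW, relLogDeriv_mul]; ring
    rw [e]
    exact sub_mem (adicFiltGen_mono (by omega) (mem_adicFiltGen_of_mem_coeffIdeal (relApproxSeq hπ E hq u hu hm₁ ψ hψF hψ2 hh N).approx))
      hδW

include hu hm₁ hψF hψ2 in
/-- ★★ **`δ_E {G : 𝒩_E G = G^ψ} = {h : 𝒮_E h = π·h^ψ}`** (as an `iff`). [cite: deShalit1987, Ch. I §3.12 Corollary] -/
theorem exists_relNormTwo_eq_map_relLogDeriv_eq_iff (h : PowerSeries (unitBall E)) :
    (∃ G : (PowerSeries (unitBall E))ˣ,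
      relNormTwo hπ E hq (G : PowerSeries (unitBall E)) = PowerSeries.map (ψ : unitBall E →+* unitBall E) G ∧ relLogDeriv hπ E G = h) ↔
      relTraceTwo hπ E hq h = PowerSeries.C (algebraMap 𝒪[F] (unitBall E) π) * PowerSeries.map (ψ : unitBall E →+* unitBall E) h := by
  have hψa : ∀ a : LTCoeff F, (ψ : unitBall E →+* unitBall E) (algebraMap (LTCoeff F) (unitBall E) a) =
      algebraMap (LTCoeff F) (unitBall E) a := hψF
  constructor
  · rintro ⟨G, hG, rfl⟩
    exact relTraceTwo_relLogDeriv_of_relNormTwo_eq_map hπ E hq hψa G hG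
  · intro hh'
    obtain ⟨G, hG1, -, hG3⟩ := exists_relNormTwo_eq_map_relLogDeriv_eq hπ E hq u hu hm₁ ψ hψF hψ2 hh'
    exact ⟨G, hG1, hG3⟩

end RelativeLimit

end Literature.NumberTheory.GaloisRepresentations
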